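import Summits.QuantumFields.BalabanUV.Beta.D1BFx.RestKernelSandwichUnit
import Summits.QuantumFields.BalabanUV.Beta.D1BFx.RestLegEnvelopes
import Summits.QuantumFields.BalabanUV.Beta.D1BFx.NlegKHessSplit

/-!
# `BalabanUV.Beta.D1BFx.RestKernelBlockUnit` — road «BF-x» for binder row D1, slot (K), DICT-CHAIN-SPEC §2 (II) row RK-BLK: **«RK-BLK GENERIC-IN-JETS» —
# THE 3 + 15 BLOCK WORDS `RestKernelWords.blockWord K V W u` ARE (5.10)-KERNELS IN THE MASS CURRENCY, GENERIC IN THE PACKED JETS `V`, `W` WITH THE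
# JETS' BLOCK MASSES DISPLAYED**, and at the road's N-leg `K := NlegRoad m a` the four block legs are read BY NAME with n-explicit letters (ff = `½Ga − ½·sandwich`
# by `RestKernelSandwichUnit.exists_road_legs`, fm ∕ mf = `ℋ_R` ∕ `ℋ♭_R` by `RestLegEnvelopes.decays_blk_NlegRoad_fm ∕ _mf` — power `n⁻⁵`, mm = multiplier by
# `decays_blk_NlegRoad_mm` — power `n⁻⁸`), modulo [B5, Prop. 1.2] ∧ [B5, (1.126)–(1.127)] BY NAME (`h12 ∕ h126`, the leg files' only printed inputs)

STATUS: [folklore] assembly BY NAME of this lineage's FILE 1b mass currency (`GhostWordFamilies.decay510_tadpoleWord_of_mass` ∕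
`decay510_biBubbleWord_of_decays_bdd_mass`) with leaf-01's leg letters; the exact twin, for the BLOCK words, of leaf-01 g21∕g22's «RK-SAND GENERIC-IN-JETS»
`RestKernelSandwichUnit` (p318931).  0 `sorry`; 0 new definitions; 0 notation; 0 cited facts beyond the two named hypotheses `h12 ∕ h126` the leg files
already carry.  HONEST: 0 root-level binders discharged (hW ∕ hR-sockets ∕ hSX-socket ∕ D1Tel ∕ D1Rep — 0); (K) NOT closed (the N-side dictionary (A2-N) must
still supply the jets' BLOCK masses `mV j k`, `mW j i` with their n-powers, and the slot needs ALL of `υ` + `hptw`); NOT D1, NOT `BetaPertH`, NOT continuum, NOT Clay.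
HONEST DEPENDENCY (cell records, verbatim): «continuum YM on T⁴ ⇐ BetaPertH ∧ nine spine estimates (0/9 proved); BetaPertH ⇐ (D1) ∧ (D4) ∧
CAP+tail; G-an2-4 gates asym, D1 and NE2/3/4.»

ABSOLUTE RULE (cell charter, verbatim): «No internally-minted statement may enter as a cited fact. Every hypothesis is either kernel-proved in
this package or a verbatim quotation of a PUBLISHED theorem with page reference. The manuscript(s) under audit are NOT citable for their own
disputed steps — they are the thing under adjudication; programme-internal (2001/route/tribunal) claims are never citable.»

WHY (`HOME/b2b-balaban-beta-d1-p2/DICT-CHAIN-SPEC.md` §2 (II) row RK-BLK — «`blockTerms (NlegRoad …) 𝒱N 𝒲N` — 3 tadpoles + 15 bi-bubbles, each with ≥ 1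
`ℋ_R = Ga𝒬ᵀCun′` ∕ `ℋ♭_R` ∕ multiplier leg against the fm∕mf∕mm blocks of the jets … OPEN — CLAIMABLE after «WH-ENV»∕«CUN-ENV»»; both envelopes are TREE
THEOREMS since leaf-01 g20's «ENV-IN-TREE» ∕ `RestLegEnvelopes` p310205; the row stood «B-A8 unseated» in every owner census §v4.25–§v4.27).  After «NLEG-HESS-SPLIT»
(`NlegKHessSplit.hessKer_NlegRoad_split`) and «RK-WORDS» (`RestKernelWords.blockTerms_eq_sum_blockWord`) the block channel of the road's (K) rest row is the
finite sum of the eighteen named words `blockWord (NlegRoad m a) V W u`, `u ∈ (Bool × Bool) ⊕ Bool⁴` (sides `true` = field, `false` = multiplier); this file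
bounds EACH WORD by the product of ONE leg letter per `K`-block and ONE mass letter per jet block — nothing about which tables the jets are.
`n = m + 1` throughout §2–§3.

CONTENT.
* §1 [folklore, any `D`, packed fibre `F ⊕ F`, any packed `K`, packed families `V W`; letters indexed by the sides `i j : Bool`] the word rows:
  **`decay510_blockWord_inl`** (the tadpole word `½·𝟙[(i,j) ≠ (f,f)]·tadpole K_ij (W μ 0 ν z)_ji`: `Bdd (blk K i j) (S i j)` and the table block's mass letter
  `Σ'|blk (W μ 0 ν z) j i| ≤ mW j i·e^{−κ|z|₁}` ⊢ constant `½·(S i j·mW j i)`, rate `κ`; the all-field slot trivially), its `Decays`-leg form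
  `decay510_blockWord_inl_of_decays`; **`decay510_blockWord_inr`** (the bubble word `−½·𝟙[¬ all f]·biBubble K_ij (V μ 0)_jk K_kl (V ν z)_li`: all four `K`-blocks
  `Decays · (S i j) σ` at one rate `σ ≥ 0`, the vertex family's BLOCK centred weighted masses `≤ mV j k` (centre `N•y`, rate `σ`, every direction) ⊢ constant
  `½·(S i j·S k l·mV j k·mV l i)`, rate `σ·N`); the (1.22) read-outs **`absMoment₂_blockWord_inl ∕ _inr`**, **`abs_secondMoment_blockWord_inl ∕ _inr`**
  (`|M₂| ≤ constant × Σ'_x |x|₁² e^{−rate|x|₁}`, `B12Sec2to5.secondMoment_abs_le_of_decay510`).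
* §2 [`D = 4`, mod `h12 ∧ h126`] **`exists_road_block_legs`**: ONE n-free triple `kG, K ≥ 0`, `c > 0` with, for every `m` and every side pair `(i, j)`,
  `Decays (blk (NlegRoad m a) i j) (T i j) (c∕n)` where `T true true = kG∕2 + K∕2∕n²` (ff: `NlegKHessSplit.blk_NlegK_tt` + `exists_road_legs` + `decays_add_min`),
  `T true false = T false true = (n⁵)⁻¹·C₄·e^{κ′}` (`ℋ_R` ∕ `ℋ♭_R`: «WH-ENV»), `T false false = 2·(n⁸)⁻¹·c166Z 3` (multiplier: «CUN-ENV», unconditional),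
  `C₄ = MG163 4·periodConst (kappa163 4) 3`, `κ′ = kappa163 4∕4`, `c = min c_RS (min (κ′∕4) (kappaZ 3))` with `c_RS = min (δ_G∕4) c_sand` the scale-`n` rate of
  RK-SAND's `exists_road_legs` — so RK-BLK's common rate is SMALLER than RK-SAND's; harmless for the (K) slot: every `Rk`-member carries its own `Decay510` ∕
  `AbsMoment₂` rows at its own positive rate in the `RestKernelGhostWiring` pattern, no common rate across members is needed; and `leg_letters_nonneg`, **`road_block_leg_le`** (every entry `≤ kG∕2 + K∕2 + C₄·e^{κ′} + 2·c166Z 3`, n-free), **`road_block_leg_nonff_le`** (every NON-ff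
  entry `≤ (n⁵)⁻¹·(C₄·e^{κ′} + 2·c166Z 3)`) — THE LOCATED COUNT: every one of the 3 + 15 genuine words carries at least one non-ff `K`-block, hence ONE
  DISPLAYED FACTOR `n⁻⁵`, times the jets' block masses (whose n-powers are (A2-N)'s).
* §3 [mod `h12 ∧ h126`] **`exists_decay510_blockWord_road`**: for every `m`, every PACKED jet pair `(V, W)` (fibre `Fib 3`, coarse bonds of blocking `n`) whose
  block masses are displayed at a rate `σ ≤ c∕n`, the eighteen road words are `Decay510` with constants `½·T_ij·mW_ji` (tadpoles, rate `κ`) and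
  `½·T_ij·T_kl·mV_jk·mV_li` (bubbles, rate `σ·n`).
NOT HERE (honest): the jets' block masses (row (A2-N) ∕ the OWNER's (B3) PART 3); the `Rk`-member wiring of these words (after (A2-N), `RestKernelGhostWiring`
pattern, leaf-01's lane); RK-X4; any statement about Bałaban's tables.
Unit `b2b-balaban-beta-d1-formalise-leaf-04` (gen 19), D1 formalisation swarm leaf prover 04, road «BF-x»; INTENT 1 «RK-BLK GENERIC-IN-JETS» (journal
[D1LEAF04-G19-ONLINE]).
-/

noncomputable section

open Finset
open scoped BigOperators
open Literature.MathematicalPhysics.QuantumFieldTheory.Balaban1983to89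
open Literature.MathematicalPhysics.QuantumFieldTheory.Balaban1983to89.Beta
open B12Sec2to5 (l1 l1_nonneg Decay510 secondMoment_abs_le_of_decay510)
open B5Hk163Strip (kappa163 kappa163_pos)
open B5Hk163Decay (MG163)
open B4TorusKernel (periodConst)
open ExpKernelCalculus (Site MKer Decays tadpole)
open KernelWard (Bdd bdd_of_decays)
open DecimatedMomentSummable (AbsMoment₂ absMoment₂_of_decay510)
open OneStepResolventKernel (Fib)
open VectorTailsLoc (fam kfam)
open Summit.QuantumFields.BalabanUV.Beta.TameKernelCalculus (decays_of_le)
open Summit.QuantumFields.BalabanUV.Beta.D1BFx.PackedKernelSplit (blk biBubble)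
open Summit.QuantumFields.BalabanUV.Beta.D1BFx.CoarseGramInverse (multM)
open Summit.QuantumFields.BalabanUV.Beta.D1BFx.RWeightedLegPack (sandP NlegRoad)
open Summit.QuantumFields.BalabanUV.Beta.D1BFx.GluonLeg (Ga)
open Summit.QuantumFields.BalabanUV.Beta.D1BFx.FrozenLegTails (nOf MOf hn1)
open Summit.QuantumFields.BalabanUV.Beta.GAN24.DirichletExhaustionDeltaZ (c166Z kappaZ kappaZ_pos)
open Summit.QuantumFields.BalabanUV.Beta.D1BFx.RestKernelWords (blockWord)
open Summit.QuantumFields.BalabanUV.Beta.D1BFx.RestKernelAbsMoment (decays_add_min)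
open Summit.QuantumFields.BalabanUV.Beta.D1BFx.RestLegEnvelopes (decays_blk_NlegRoad_mm decays_blk_NlegRoad_fm decays_blk_NlegRoad_mf)
open Summit.QuantumFields.BalabanUV.Beta.D1BFx.RestKernelSandwichUnit (exists_road_legs)
open Summit.QuantumFields.BalabanUV.Beta.D1BFx.NlegKHessSplit (blk_NlegK_tt)
open Summit.QuantumFields.BalabanUV.Beta.D1BFx.GhostWordFamilies (decay510_tadpoleWord_of_mass decay510_biBubbleWord_of_decays_bdd_mass)

namespace Summit.QuantumFields.BalabanUV.Beta.D1BFx.RestKernelBlockUnit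

/-! ## §1 The word rows, generic packed legs and packed jets -/

section Words

variable {D : ℕ} {F : Type*} [Fintype F] {K : MKer D (F ⊕ F)} {V : Fin D → Site D → MKer D (F ⊕ F)}
  {W : Fin D → Site D → Fin D → Site D → MKer D (F ⊕ F)} {S mV mW : Bool → Bool → ℝ} {σ κ : ℝ} {N : ℕ}

/-- [folklore] A table block mass letter forces its constant to be nonnegative (`e^{−κ|z|₁} > 0`). -/
theorem mass_letter_nonneg {μ ν : Fin D}
    (hWm : ∀ z j i, ∑' p : Site D × Site D, ∑ g, ∑ f, |blk (W μ 0 ν z) j i p.1 p.2 g f| ≤ mW j i * Real.exp (-κ * l1 z)) (j i : Bool) :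
    0 ≤ mW j i := by
  have h : (0 : ℝ) ≤ mW j i * Real.exp (-κ * l1 (0 : Site D)) :=
    (tsum_nonneg fun p => Finset.sum_nonneg fun g _ => Finset.sum_nonneg fun f _ => abs_nonneg _).trans (hWm 0 j i)
  exact (mul_nonneg_iff_of_pos_right (Real.exp_pos _)).1 h

/-- [folklore] A vertex block mass letter forces its constant to be nonnegative. -/
theorem vertex_letter_nonneg
    (hVm : ∀ ρ y j k, ∑' p : Site D × Site D,
      ∑ g, ∑ f, |blk (V ρ y) j k p.1 p.2 g f| * Real.exp (σ * (l1 (p.1 - (N : ℤ) • y) + l1 (p.2 - (N : ℤ) • y))) ≤ mV j k)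
    (ρ : Fin D) (j k : Bool) : 0 ≤ mV j k :=
  (tsum_nonneg fun p => Finset.sum_nonneg fun g _ => Finset.sum_nonneg fun f _ => by positivity).trans (hVm ρ 0 j k)

/-- [folklore] **THE TADPOLE BLOCK WORDS** `u = inl (i, j)` (`½·𝟙[(i,j) ≠ (f,f)]·tadpole K_ij (W μ 0 ν z)_ji`): the `K`-blocks' sup letters `Bdd (blk K i j) (S i j)`
(`0 ≤ S`) and the table blocks' mass letters `Σ'_{(y,x)} Σ_{g f} |(W μ 0 ν z)_ji y x g f| ≤ mW j i·e^{−κ|z|₁}` (all `z`) ⊢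
`Decay510 (blockWord K V W (inl (i, j)) μ ν) (½·(S i j·mW j i)) κ` — the all-field slot `(true, true)` (word `0`) trivially. -/
theorem decay510_blockWord_inl (hK : ∀ i j, Bdd (blk K i j) (S i j)) (hS : ∀ i j, 0 ≤ S i j) (μ ν : Fin D)
    (hWs : ∀ z j i, Summable fun p : Site D × Site D => ∑ g, ∑ f, |blk (W μ 0 ν z) j i p.1 p.2 g f|)
    (hWm : ∀ z j i, ∑' p : Site D × Site D, ∑ g, ∑ f, |blk (W μ 0 ν z) j i p.1 p.2 g f| ≤ mW j i * Real.exp (-κ * l1 z))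
    (i j : Bool) :
    Decay510 (blockWord K V W (Sum.inl (i, j)) μ ν) ((1 / 2) * (S i j * mW j i)) κ := by
  have h := decay510_tadpoleWord_of_mass (𝒲 := fun μ' y ν' y' => blk (W μ' y ν' y') j i) (hK i j) (hS i j) μ ν
    (fun z => hWs z j i) (fun z => hWm z j i)
  have hmW : 0 ≤ mW j i := mass_letter_nonneg hWm j i
  intro z
  cases hb : (i && j)
  · simp only [blockWord, hb, cond_false]
    rw [abs_mul, abs_of_pos (by norm_num : (0 : ℝ) < 1 / 2), mul_assoc]
    exact mul_le_mul_of_nonneg_left (h z) (by norm_num)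
  · simp only [blockWord, hb, cond_true, mul_zero, abs_zero]
    exact mul_nonneg (mul_nonneg (by norm_num) (mul_nonneg (hS i j) hmW)) (Real.exp_pos _).le

/-- [folklore] The same with the `K`-blocks given by `Decays` letters at a rate `σ ≥ 0` (`KernelWard.bdd_of_decays`). -/
theorem decay510_blockWord_inl_of_decays (hK : ∀ i j, Decays (blk K i j) (S i j) σ) (hσ : 0 ≤ σ) (hS : ∀ i j, 0 ≤ S i j) (μ ν : Fin D)
    (hWs : ∀ z j i, Summable fun p : Site D × Site D => ∑ g, ∑ f, |blk (W μ 0 ν z) j i p.1 p.2 g f|)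
    (hWm : ∀ z j i, ∑' p : Site D × Site D, ∑ g, ∑ f, |blk (W μ 0 ν z) j i p.1 p.2 g f| ≤ mW j i * Real.exp (-κ * l1 z))
    (i j : Bool) :
    Decay510 (blockWord K V W (Sum.inl (i, j)) μ ν) ((1 / 2) * (S i j * mW j i)) κ :=
  decay510_blockWord_inl (fun i' j' => bdd_of_decays (hK i' j') hσ) hS μ ν hWs hWm i j

/-- [folklore] **THE BUBBLE BLOCK WORDS** `u = inr (i, j, k, l)` (`−½·𝟙[¬(i ∧ j ∧ k ∧ l)]·biBubble K_ij (V μ 0)_jk K_kl (V ν z)_li`): all `K`-blocks decaying at ONE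
rate `σ ≥ 0` (`Decays (blk K i j) (S i j) σ`, `0 ≤ S`) and the vertex family's BLOCK centred weighted masses
`Σ'_{(p,q)} Σ_{g f} |(V ρ y)_jk p q g f|·e^{σ(|p − N•y|₁ + |q − N•y|₁)} ≤ mV j k` (every direction `ρ`, every bond `y`, every block) ⊢
`Decay510 (blockWord K V W (inr (i, j, k, l)) μ ν) (½·(S i j·S k l·mV j k·mV l i)) (σ·N)` — decay on the first leg, sup on the second; the all-field slot trivially. -/
theorem decay510_blockWord_inr (hK : ∀ i j, Decays (blk K i j) (S i j) σ) (hσ : 0 ≤ σ) (hS : ∀ i j, 0 ≤ S i j) (μ ν : Fin D)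
    (hVs : ∀ ρ y j k, Summable fun p : Site D × Site D =>
      ∑ g, ∑ f, |blk (V ρ y) j k p.1 p.2 g f| * Real.exp (σ * (l1 (p.1 - (N : ℤ) • y) + l1 (p.2 - (N : ℤ) • y))))
    (hVm : ∀ ρ y j k, ∑' p : Site D × Site D,
      ∑ g, ∑ f, |blk (V ρ y) j k p.1 p.2 g f| * Real.exp (σ * (l1 (p.1 - (N : ℤ) • y) + l1 (p.2 - (N : ℤ) • y))) ≤ mV j k)
    (i j k l : Bool) :
    Decay510 (blockWord K V W (Sum.inr (i, j, k, l)) μ ν) ((1 / 2) * (S i j * S k l * mV j k * mV l i)) (σ * N) := by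
  have h := decay510_biBubbleWord_of_decays_bdd_mass (𝒱 := fun ρ y => blk (V ρ y) j k) (𝒱' := fun ρ y => blk (V ρ y) l i)
    (hK i j) (bdd_of_decays (hK k l) hσ) hσ (hS i j) (hS k l) μ ν
    (fun y => hVs μ y j k) (fun y => hVm μ y j k) (fun y => hVs ν y l i) (fun y => hVm ν y l i)
  have hmV : ∀ j' k', 0 ≤ mV j' k' := fun j' k' => vertex_letter_nonneg hVm μ j' k'
  intro z
  cases hb : (i && j && k && l)
  · simp only [blockWord, hb, cond_false]
    rw [abs_mul, abs_neg, abs_of_pos (by norm_num : (0 : ℝ) < 1 / 2), mul_assoc]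
    exact mul_le_mul_of_nonneg_left (h z) (by norm_num)
  · simp only [blockWord, hb, cond_true, mul_zero, abs_zero]
    exact mul_nonneg (mul_nonneg (by norm_num)
      (mul_nonneg (mul_nonneg (mul_nonneg (hS i j) (hS k l)) (hmV j k)) (hmV l i))) (Real.exp_pos _).le

/-- [folklore] (1.22) read-out of the tadpole block words: `0 < κ` ⊢ `AbsMoment₂` (the `hMR` row shape). -/
theorem absMoment₂_blockWord_inl (hK : ∀ i j, Bdd (blk K i j) (S i j)) (hS : ∀ i j, 0 ≤ S i j) (μ ν : Fin D)
    (hWs : ∀ z j i, Summable fun p : Site D × Site D => ∑ g, ∑ f, |blk (W μ 0 ν z) j i p.1 p.2 g f|)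
    (hWm : ∀ z j i, ∑' p : Site D × Site D, ∑ g, ∑ f, |blk (W μ 0 ν z) j i p.1 p.2 g f| ≤ mW j i * Real.exp (-κ * l1 z)) (hκ : 0 < κ)
    (i j : Bool) : AbsMoment₂ (blockWord K V W (Sum.inl (i, j)) μ ν) :=
  absMoment₂_of_decay510 hκ (decay510_blockWord_inl hK hS μ ν hWs hWm i j)

/-- [folklore] (1.22) read-out of the tadpole block words: `|M₂[blockWord … (inl (i, j))]_{μν}| ≤ ½·(S i j·mW j i) · Σ'_x |x|₁² e^{−κ|x|₁}`. -/
theorem abs_secondMoment_blockWord_inl (hK : ∀ i j, Bdd (blk K i j) (S i j)) (hS : ∀ i j, 0 ≤ S i j) (μ ν : Fin D)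
    (hWs : ∀ z j i, Summable fun p : Site D × Site D => ∑ g, ∑ f, |blk (W μ 0 ν z) j i p.1 p.2 g f|)
    (hWm : ∀ z j i, ∑' p : Site D × Site D, ∑ g, ∑ f, |blk (W μ 0 ν z) j i p.1 p.2 g f| ≤ mW j i * Real.exp (-κ * l1 z)) (hκ : 0 < κ)
    (i j : Bool) :
    |B12Beta.secondMoment (blockWord K V W (Sum.inl (i, j))) μ ν| ≤ (1 / 2) * (S i j * mW j i) * ∑' x : Site D, l1 x ^ 2 * Real.exp (-κ * l1 x) :=
  (secondMoment_abs_le_of_decay510 hκ (decay510_blockWord_inl hK hS μ ν hWs hWm i j)).2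

/-- [folklore] (1.22) read-out of the bubble block words: `0 < σ`, `1 ≤ N` ⊢ `AbsMoment₂` (the `hMR` row shape). -/
theorem absMoment₂_blockWord_inr (hK : ∀ i j, Decays (blk K i j) (S i j) σ) (hσ : 0 < σ) (hS : ∀ i j, 0 ≤ S i j) (hN : 1 ≤ N) (μ ν : Fin D)
    (hVs : ∀ ρ y j k, Summable fun p : Site D × Site D =>
      ∑ g, ∑ f, |blk (V ρ y) j k p.1 p.2 g f| * Real.exp (σ * (l1 (p.1 - (N : ℤ) • y) + l1 (p.2 - (N : ℤ) • y))))
    (hVm : ∀ ρ y j k, ∑' p : Site D × Site D,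
      ∑ g, ∑ f, |blk (V ρ y) j k p.1 p.2 g f| * Real.exp (σ * (l1 (p.1 - (N : ℤ) • y) + l1 (p.2 - (N : ℤ) • y))) ≤ mV j k)
    (i j k l : Bool) : AbsMoment₂ (blockWord K V W (Sum.inr (i, j, k, l)) μ ν) :=
  absMoment₂_of_decay510 (mul_pos hσ (by exact_mod_cast hN)) (decay510_blockWord_inr hK hσ.le hS μ ν hVs hVm i j k l)

/-- [folklore] (1.22) read-out of the bubble block words: `|M₂[blockWord … (inr (i, j, k, l))]_{μν}| ≤ ½·(S i j·S k l·mV j k·mV l i) · Σ'_z |z|₁² e^{−σN|z|₁}`. -/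
theorem abs_secondMoment_blockWord_inr (hK : ∀ i j, Decays (blk K i j) (S i j) σ) (hσ : 0 < σ) (hS : ∀ i j, 0 ≤ S i j) (hN : 1 ≤ N)
    (μ ν : Fin D)
    (hVs : ∀ ρ y j k, Summable fun p : Site D × Site D =>
      ∑ g, ∑ f, |blk (V ρ y) j k p.1 p.2 g f| * Real.exp (σ * (l1 (p.1 - (N : ℤ) • y) + l1 (p.2 - (N : ℤ) • y))))
    (hVm : ∀ ρ y j k, ∑' p : Site D × Site D,
      ∑ g, ∑ f, |blk (V ρ y) j k p.1 p.2 g f| * Real.exp (σ * (l1 (p.1 - (N : ℤ) • y) + l1 (p.2 - (N : ℤ) • y))) ≤ mV j k)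
    (i j k l : Bool) :
    |B12Beta.secondMoment (blockWord K V W (Sum.inr (i, j, k, l))) μ ν|
      ≤ (1 / 2) * (S i j * S k l * mV j k * mV l i) * ∑' z : Site D, l1 z ^ 2 * Real.exp (-(σ * N) * l1 z) :=
  (secondMoment_abs_le_of_decay510 (mul_pos hσ (by exact_mod_cast hN)) (decay510_blockWord_inr hK hσ.le hS μ ν hVs hVm i j k l)).2

end Words

/-! ## §2 The road's four block legs at one n-free scale-`n` rate (mod `h12 ∧ h126`) -/

section Road

variable {a : ℝ} (ha : 0 < a)
include ha

/-- [folklore] **THE FOUR BLOCKS OF THE ROAD's N-LEG DECAY AT ONE COMMON RATE `c∕n`, n-EXPLICIT LETTERS** (mod [B5, Prop. 1.2] ∧ [B5, (1.126)–(1.127)] BY NAME):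
one triple `kG, K ≥ 0`, `c > 0`, chosen before `n`, such that for every `m` (`n = m + 1`) and every side pair `(i, j)`
`Decays (blk (NlegRoad m a) i j) (T i j) (c∕n)` with the table `T true true = kG∕2 + K∕2∕n²` (the ff block `½•Ga + (−½)•sandwich_ff`,
`NlegKHessSplit.blk_NlegK_tt` + `RestKernelSandwichUnit.exists_road_legs`), `T true false = T false true = (n⁵)⁻¹·(MG163 4·periodConst (kappa163 4) 3)·e^{kappa163 4∕4}`
(«WH-ENV»: `RestLegEnvelopes.decays_blk_NlegRoad_fm ∕ _mf`), `T false false = 2·(n⁸)⁻¹·c166Z 3` («CUN-ENV»: `decays_blk_NlegRoad_mm`, unconditional);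
`c = min c_RS (min (kappa163 4∕16) (kappaZ 3))`, `c_RS` the rate of `RestKernelSandwichUnit.exists_road_legs` (so `c ≤ c_RS`: a smaller common rate than
RK-SAND's — harmless, each `Rk`-member is wired at its own rate). -/
theorem exists_road_block_legs (h12 : B5.Prop12Printed (fam nOf hn1 MOf a ha)) (h126 : B5.Kernel126_127Printed (kfam nOf MOf)) :
    ∃ kG K c : ℝ, 0 < c ∧ 0 ≤ kG ∧ 0 ≤ K ∧ ∀ (m : ℕ) (i j : Bool),
      Decays (blk (NlegRoad m a) i j)
        (bif (i && j) then kG / 2 + K / 2 / (((m + 1 : ℕ) : ℝ)) ^ 2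
          else bif (i || j) then
            ((((m + 1 : ℕ) : ℝ)) ^ 5)⁻¹ * (MG163 4 * periodConst (kappa163 4) 3) * Real.exp (kappa163 4 / 4)
          else 2 * ((((m + 1 : ℕ) : ℝ)) ^ 8)⁻¹ * c166Z 3)
        (c / ((m + 1 : ℕ) : ℝ)) := by
  obtain ⟨kG, K, c, hc, hkG, hK, hlegs⟩ := exists_road_legs ha h12 h126
  have hκ4 : 0 < kappa163 4 := kappa163_pos 4
  refine ⟨kG, K, min c (min (kappa163 4 / 16) (kappaZ 3)), lt_min hc (lt_min (by positivity) (kappaZ_pos 3)), hkG, hK,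
    fun m i j => ?_⟩
  have hn : (0 : ℝ) < ((m + 1 : ℕ) : ℝ) := by exact_mod_cast Nat.succ_pos m
  set c' : ℝ := min c (min (kappa163 4 / 16) (kappaZ 3)) with hc'
  have hc'c : c' ≤ c := min_le_left _ _
  have hc'κ : c' ≤ kappa163 4 / 16 := (min_le_right _ _).trans (min_le_left _ _)
  have hc'Z : c' ≤ kappaZ 3 := (min_le_right _ _).trans (min_le_right _ _)
  -- the two `ℋ`-blocks: leaf-01's «WH-ENV» letters (stated with the numerals `3 + 1`, `3 + 2` of the generic-`d` source), rate weakened to `c'∕n`,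
  -- constant re-displayed with the numerals evaluated
  have hrate_H : c' / ((m + 1 : ℕ) : ℝ) ≤ kappa163 (3 + 1) / (3 + 1) / (4 * ((m + 1 : ℕ) : ℝ)) := by
    have e : (kappa163 (3 + 1) / (3 + 1) : ℝ) = kappa163 4 / 4 := by norm_num
    rw [e]
    calc c' / ((m + 1 : ℕ) : ℝ) ≤ (kappa163 4 / 16) / ((m + 1 : ℕ) : ℝ) := div_le_div_of_nonneg_right hc'κ hn.le
      _ = kappa163 4 / 4 / (4 * ((m + 1 : ℕ) : ℝ)) := by ring
  have hfm0 := decays_blk_NlegRoad_fm m ha h12 h126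
  have hmf0 := decays_blk_NlegRoad_mf m ha h12 h126
  have eC : |((((m + 1 : ℕ) : ℝ)) ^ (3 + 2))⁻¹ * (MG163 (3 + 1) * periodConst (kappa163 (3 + 1)) 3) * Real.exp (kappa163 (3 + 1) / (3 + 1))|
      = ((((m + 1 : ℕ) : ℝ)) ^ 5)⁻¹ * (MG163 4 * periodConst (kappa163 4) 3) * Real.exp (kappa163 4 / 4) := by
    rw [abs_of_nonneg (hfm0.nonneg 0)]
    norm_num
  have hfm : Decays (blk (NlegRoad m a) true false)
      (((((m + 1 : ℕ) : ℝ)) ^ 5)⁻¹ * (MG163 4 * periodConst (kappa163 4) 3) * Real.exp (kappa163 4 / 4)) (c' / ((m + 1 : ℕ) : ℝ)) :=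
    fun x w κ l => (decays_of_le hfm0 hrate_H x w κ l).trans (le_of_eq (by rw [eC]))
  have hmf : Decays (blk (NlegRoad m a) false true)
      (((((m + 1 : ℕ) : ℝ)) ^ 5)⁻¹ * (MG163 4 * periodConst (kappa163 4) 3) * Real.exp (kappa163 4 / 4)) (c' / ((m + 1 : ℕ) : ℝ)) :=
    fun x w κ l => (decays_of_le hmf0 hrate_H x w κ l).trans (le_of_eq (by rw [eC]))
  cases i <;> cases j
  · -- mm: the multiplier block, «CUN-ENV» (unconditional)
    show Decays (blk (NlegRoad m a) false false) (2 * ((((m + 1 : ℕ) : ℝ)) ^ 8)⁻¹ * c166Z 3) (c' / ((m + 1 : ℕ) : ℝ))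
    have hmm := decays_blk_NlegRoad_mm m a
    have hC : 0 ≤ 2 * ((((m + 1 : ℕ) : ℝ)) ^ 8)⁻¹ * c166Z 3 := hmm.nonneg 0
    have h := decays_of_le hmm (div_le_div_of_nonneg_right hc'Z hn.le)
    rwa [abs_of_nonneg hC] at h
  · -- mf: `ℋ♭_R`
    exact hmf
  · -- fm: `ℋ_R`
    exact hfm
  · -- ff: `½•Ga + (−½)•sandwich_ff`
    show Decays (blk (NlegRoad m a) true true) (kG / 2 + K / 2 / (((m + 1 : ℕ) : ℝ)) ^ 2) (c' / ((m + 1 : ℕ) : ℝ))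
    obtain ⟨hA, hB⟩ := hlegs m
    have e : blk (NlegRoad m a) true true = (2 : ℝ)⁻¹ • Ga (m + 1) a
        + (-(2 : ℝ)⁻¹) • blk (sandP (m + 1) (Ga (m + 1) a) (multM (m + 1) (2 * a / ((m + 1 : ℕ) : ℝ) ^ 8) 2)) true true :=
      blk_NlegK_tt (m + 1) (a / ((m + 1 : ℕ) : ℝ) ^ 8)
    rw [e]
    have hkG2 : (0 : ℝ) ≤ kG / 2 := by positivity
    have hK2 : (0 : ℝ) ≤ K / 2 / (((m + 1 : ℕ) : ℝ)) ^ 2 := by positivity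
    have h := decays_of_le (decays_add_min hA hB) ((div_le_div_of_nonneg_right hc'c hn.le).trans (le_of_eq (min_self _).symm))
    rwa [abs_of_nonneg hkG2, abs_of_nonneg hK2, abs_of_nonneg (add_nonneg hkG2 hK2)] at h

omit ha in
/-- [folklore] The two n-free leg letters of the table are nonnegative (`MG163_nonneg`, an even power; «CUN-ENV» read at blocking `1`). -/
theorem leg_letters_nonneg :
    0 ≤ MG163 4 * periodConst (kappa163 4) 3 * Real.exp (kappa163 4 / 4) ∧ 0 ≤ c166Z 3 := by
  refine ⟨mul_nonneg (mul_nonneg (B5Hk163Decay.MG163_nonneg 4) ?_) (Real.exp_pos _).le, ?_⟩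
  · unfold B4TorusKernel.periodConst
    exact Even.pow_nonneg (by decide) _
  · have hpos : (0 : ℝ) < 2 * ((((0 + 1 : ℕ) : ℝ)) ^ 8)⁻¹ := by positivity
    exact (mul_nonneg_iff_of_pos_left hpos).1 ((decays_blk_NlegRoad_mm 0 0).nonneg 0)

omit ha in
/-- [folklore] **THE LEG TABLE IS n-UNIFORMLY BOUNDED** (`n ≥ 1`, `kG, K ≥ 0`): every entry of the table of `exists_road_block_legs` is
`≤ kG∕2 + K∕2 + (C₄·e^{κ′} + 2·c166Z 3)`, `C₄ = MG163 4·periodConst (kappa163 4) 3`, `κ′ = kappa163 4∕4`. -/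
theorem road_block_leg_le {kG K : ℝ} (hkG : 0 ≤ kG) (hK : 0 ≤ K) (m : ℕ) (i j : Bool) :
    (bif (i && j) then kG / 2 + K / 2 / (((m + 1 : ℕ) : ℝ)) ^ 2
      else bif (i || j) then ((((m + 1 : ℕ) : ℝ)) ^ 5)⁻¹ * (MG163 4 * periodConst (kappa163 4) 3) * Real.exp (kappa163 4 / 4)
      else 2 * ((((m + 1 : ℕ) : ℝ)) ^ 8)⁻¹ * c166Z 3)
      ≤ kG / 2 + K / 2 + (MG163 4 * periodConst (kappa163 4) 3 * Real.exp (kappa163 4 / 4) + 2 * c166Z 3) := by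
  obtain ⟨hC4, hZ0⟩ := leg_letters_nonneg
  have hn1 : (1 : ℝ) ≤ ((m + 1 : ℕ) : ℝ) := by exact_mod_cast Nat.le_add_left 1 m
  have h5 : ((((m + 1 : ℕ) : ℝ)) ^ 5)⁻¹ ≤ 1 := inv_le_one_of_one_le₀ (one_le_pow₀ hn1)
  have h8 : ((((m + 1 : ℕ) : ℝ)) ^ 8)⁻¹ ≤ 1 := inv_le_one_of_one_le₀ (one_le_pow₀ hn1)
  have h2 : K / 2 / (((m + 1 : ℕ) : ℝ)) ^ 2 ≤ K / 2 := div_le_self (by positivity) (one_le_pow₀ hn1)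
  have h5C : ((((m + 1 : ℕ) : ℝ)) ^ 5)⁻¹ * (MG163 4 * periodConst (kappa163 4) 3 * Real.exp (kappa163 4 / 4))
      ≤ 1 * (MG163 4 * periodConst (kappa163 4) 3 * Real.exp (kappa163 4 / 4)) := mul_le_mul_of_nonneg_right h5 hC4
  have h8Z : ((((m + 1 : ℕ) : ℝ)) ^ 8)⁻¹ * c166Z 3 ≤ 1 * c166Z 3 := mul_le_mul_of_nonneg_right h8 hZ0
  cases i <;> cases j
  · show 2 * ((((m + 1 : ℕ) : ℝ)) ^ 8)⁻¹ * c166Z 3 ≤ _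
    nlinarith
  · show ((((m + 1 : ℕ) : ℝ)) ^ 5)⁻¹ * (MG163 4 * periodConst (kappa163 4) 3) * Real.exp (kappa163 4 / 4) ≤ _
    nlinarith
  · show ((((m + 1 : ℕ) : ℝ)) ^ 5)⁻¹ * (MG163 4 * periodConst (kappa163 4) 3) * Real.exp (kappa163 4 / 4) ≤ _
    nlinarith
  · show kG / 2 + K / 2 / (((m + 1 : ℕ) : ℝ)) ^ 2 ≤ _
    linarith

omit ha in
/-- [folklore] **THE LOCATED COUNT, AS AN INEQUALITY ON THE LEG TABLE**: every NON-ff entry (`(i && j) = false`: the `ℋ_R`, `ℋ♭_R` and multiplier legs) of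
the table of `exists_road_block_legs` is `≤ (n⁵)⁻¹·(C₄·e^{κ′} + 2·c166Z 3)` (`n⁻⁸ ≤ n⁻⁵`, `n ≥ 1`) — so each of the 3 + 15 genuine block words, having at least
one non-ff `K`-block, carries ONE DISPLAYED FACTOR `n⁻⁵` times n-free leg letters (`road_block_leg_le`) times the jets' block masses. -/
theorem road_block_leg_nonff_le (kG K : ℝ) (m : ℕ) {i j : Bool} (hij : (i && j) = false) :
    (bif (i && j) then kG / 2 + K / 2 / (((m + 1 : ℕ) : ℝ)) ^ 2
      else bif (i || j) then ((((m + 1 : ℕ) : ℝ)) ^ 5)⁻¹ * (MG163 4 * periodConst (kappa163 4) 3) * Real.exp (kappa163 4 / 4)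
      else 2 * ((((m + 1 : ℕ) : ℝ)) ^ 8)⁻¹ * c166Z 3)
      ≤ ((((m + 1 : ℕ) : ℝ)) ^ 5)⁻¹ * (MG163 4 * periodConst (kappa163 4) 3 * Real.exp (kappa163 4 / 4) + 2 * c166Z 3) := by
  obtain ⟨hC4, hZ0⟩ := leg_letters_nonneg
  have hn1 : (1 : ℝ) ≤ ((m + 1 : ℕ) : ℝ) := by exact_mod_cast Nat.le_add_left 1 m
  have h5' : 0 ≤ ((((m + 1 : ℕ) : ℝ)) ^ 5)⁻¹ := by positivity
  have h8 : ((((m + 1 : ℕ) : ℝ)) ^ 8)⁻¹ ≤ ((((m + 1 : ℕ) : ℝ)) ^ 5)⁻¹ :=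
    inv_anti₀ (by positivity) (pow_le_pow_right₀ hn1 (by norm_num))
  have h8Z : ((((m + 1 : ℕ) : ℝ)) ^ 8)⁻¹ * c166Z 3 ≤ ((((m + 1 : ℕ) : ℝ)) ^ 5)⁻¹ * c166Z 3 := mul_le_mul_of_nonneg_right h8 hZ0
  have h5C : 0 ≤ ((((m + 1 : ℕ) : ℝ)) ^ 5)⁻¹ * (MG163 4 * periodConst (kappa163 4) 3 * Real.exp (kappa163 4 / 4)) := mul_nonneg h5' hC4
  have h5Z : 0 ≤ ((((m + 1 : ℕ) : ℝ)) ^ 5)⁻¹ * c166Z 3 := mul_nonneg h5' hZ0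
  rw [hij, cond_false]
  cases hb : (i || j)
  · rw [cond_false]
    nlinarith
  · rw [cond_true]
    nlinarith

/-! ## §3 The road's eighteen block words, generic PACKED jets with displayed block masses (mod `h12 ∧ h126`) -/

/-- [folklore] **«RK-BLK GENERIC-IN-JETS»**: modulo [B5, Prop. 1.2] ∧ [B5, (1.126)–(1.127)] BY NAME there is ONE n-free triple `kG, K ≥ 0`, `c > 0` such that
for every `m` (`n = m + 1`), every PACKED jet pair `V`, `W` (fibre `Fib 3`, coarse bonds of blocking `n`), every rate `0 ≤ σ ≤ c∕n` at which the vertex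
family's BLOCK centred weighted masses are `≤ mV j k` and every family of table BLOCK mass letters `mW j i·e^{−κ|z|₁}`, the 3 + 15 block words of the (K)
rest row over the road's N-leg (`NlegKHessSplit.hessKer_NlegRoad_split`, `RestKernelWords.blockTerms_eq_sum_blockWord`) satisfy
`Decay510 (blockWord (NlegRoad m a) V W (inl (i, j)) μ ν) (½·(T i j·mW j i)) κ` and
`Decay510 (blockWord (NlegRoad m a) V W (inr (i, j, k, l)) μ ν) (½·(T i j·T k l·mV j k·mV l i)) (σ·n)` with the leg table `T` of `exists_road_block_legs`
(ff `kG∕2 + K∕2∕n²`, fm∕mf `(n⁵)⁻¹·C₄·e^{κ′}`, mm `2·(n⁸)⁻¹·c166Z 3`) — one displayed `n⁻⁵` per genuine word (`road_block_leg_nonff_le`); the jets' block masses and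
their n-powers are (A2-N)'s.  The (1.22) rows follow by §1 (`abs_secondMoment_blockWord_inl ∕ _inr`, `absMoment₂_blockWord_inl ∕ _inr`). -/
theorem exists_decay510_blockWord_road (h12 : B5.Prop12Printed (fam nOf hn1 MOf a ha)) (h126 : B5.Kernel126_127Printed (kfam nOf MOf)) :
    ∃ kG K c : ℝ, 0 < c ∧ 0 ≤ kG ∧ 0 ≤ K ∧ ∀ (m : ℕ) (V : Fin 4 → Site 4 → MKer 4 (Fib 3))
      (W : Fin 4 → Site 4 → Fin 4 → Site 4 → MKer 4 (Fib 3)) (σ κ : ℝ) (mV mW : Bool → Bool → ℝ) (μ ν : Fin 4),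
      0 ≤ σ → σ ≤ c / ((m + 1 : ℕ) : ℝ) →
      (∀ ρ y j k, Summable fun p : Site 4 × Site 4 =>
        ∑ g, ∑ f, |blk (V ρ y) j k p.1 p.2 g f| * Real.exp (σ * (l1 (p.1 - ((m + 1 : ℕ) : ℤ) • y) + l1 (p.2 - ((m + 1 : ℕ) : ℤ) • y)))) →
      (∀ ρ y j k, ∑' p : Site 4 × Site 4,
        ∑ g, ∑ f, |blk (V ρ y) j k p.1 p.2 g f| * Real.exp (σ * (l1 (p.1 - ((m + 1 : ℕ) : ℤ) • y) + l1 (p.2 - ((m + 1 : ℕ) : ℤ) • y)))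
          ≤ mV j k) →
      (∀ z j i, Summable fun p : Site 4 × Site 4 => ∑ g, ∑ f, |blk (W μ 0 ν z) j i p.1 p.2 g f|) →
      (∀ z j i, ∑' p : Site 4 × Site 4, ∑ g, ∑ f, |blk (W μ 0 ν z) j i p.1 p.2 g f| ≤ mW j i * Real.exp (-κ * l1 z)) →
      (∀ i j : Bool, Decay510 (blockWord (NlegRoad m a) V W (Sum.inl (i, j)) μ ν)
          ((1 / 2) * ((bif (i && j) then kG / 2 + K / 2 / (((m + 1 : ℕ) : ℝ)) ^ 2
            else bif (i || j) then ((((m + 1 : ℕ) : ℝ)) ^ 5)⁻¹ * (MG163 4 * periodConst (kappa163 4) 3) * Real.exp (kappa163 4 / 4)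
            else 2 * ((((m + 1 : ℕ) : ℝ)) ^ 8)⁻¹ * c166Z 3) * mW j i)) κ) ∧
      (∀ i j k l : Bool, Decay510 (blockWord (NlegRoad m a) V W (Sum.inr (i, j, k, l)) μ ν)
          ((1 / 2) * ((bif (i && j) then kG / 2 + K / 2 / (((m + 1 : ℕ) : ℝ)) ^ 2
              else bif (i || j) then ((((m + 1 : ℕ) : ℝ)) ^ 5)⁻¹ * (MG163 4 * periodConst (kappa163 4) 3) * Real.exp (kappa163 4 / 4)
              else 2 * ((((m + 1 : ℕ) : ℝ)) ^ 8)⁻¹ * c166Z 3)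
            * (bif (k && l) then kG / 2 + K / 2 / (((m + 1 : ℕ) : ℝ)) ^ 2
              else bif (k || l) then ((((m + 1 : ℕ) : ℝ)) ^ 5)⁻¹ * (MG163 4 * periodConst (kappa163 4) 3) * Real.exp (kappa163 4 / 4)
              else 2 * ((((m + 1 : ℕ) : ℝ)) ^ 8)⁻¹ * c166Z 3)
            * mV j k * mV l i)) (σ * ((m + 1 : ℕ) : ℝ))) := by
  obtain ⟨kG, K, c, hc, hkG, hK, hlegs⟩ := exists_road_block_legs ha h12 h126
  refine ⟨kG, K, c, hc, hkG, hK, fun m V W σ κ mV mW μ ν hσ0 hσc hVs hVm hWs hWm => ?_⟩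
  -- the leg table at blocking `n`, as a function of the sides
  set T : Bool → Bool → ℝ := fun i j =>
    bif (i && j) then kG / 2 + K / 2 / (((m + 1 : ℕ) : ℝ)) ^ 2
      else bif (i || j) then ((((m + 1 : ℕ) : ℝ)) ^ 5)⁻¹ * (MG163 4 * periodConst (kappa163 4) 3) * Real.exp (kappa163 4 / 4)
      else 2 * ((((m + 1 : ℕ) : ℝ)) ^ 8)⁻¹ * c166Z 3 with hT
  have hKT : ∀ i j, Decays (blk (NlegRoad m a) i j) (T i j) (c / ((m + 1 : ℕ) : ℝ)) := fun i j => hlegs m i j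
  have hT0 : ∀ i j, 0 ≤ T i j := fun i j => (hKT i j).nonneg 0
  -- all four legs at the jets' rate `σ ≤ c∕n`
  have hKσ : ∀ i j, Decays (blk (NlegRoad m a) i j) (T i j) σ := fun i j => by
    have h := decays_of_le (hKT i j) hσc
    rwa [abs_of_nonneg (hT0 i j)] at h
  refine ⟨fun i j => ?_, fun i j k l => ?_⟩
  · exact decay510_blockWord_inl_of_decays (K := NlegRoad m a) (V := V) hKσ hσ0 hT0 μ ν hWs hWm i j
  · exact decay510_blockWord_inr (N := m + 1) hKσ hσ0 hT0 μ ν hVs hVm i j k l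

end Road

end Summit.QuantumFields.BalabanUV.Beta.D1BFx.RestKernelBlockUnit

end
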